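import Summits.QuantumFields.BalabanUV.T4Continuum.Support.NE7ExactCurrent
import Summits.QuantumFields.BalabanUV.T4Continuum.Support.NE3CpushGaugeCovariance
import Summits.QuantumFields.BalabanUV.T4Continuum.Support.NE7EtaMinimiserGaugeCovariance
import Summits.QuantumFields.BalabanUV.T4Continuum.Support.NE3GaugeDirFrames
import Summits.QuantumFields.BalabanUV.T4Continuum.Support.NE3EnergyAssembly
import Summits.QuantumFields.BalabanUV.T4Continuum.Support.NE3CovariantBlockPoincare
import HarnessLib

/-!
# NE7TanCriticalGauge — TANGENT-CRITICALITY IS GAUGE COVARIANT: the «criticality at the representative» clause of F38's letter bundle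
# (`NE7ApeFlatSkeleton.hape_of_flatLetters`) DISCHARGED for periodic unitary gauges

Cell `pub-balaban`, rung (B)+1 sub-cell t4, lineage `b2b-balaban-t4-ne7-p1`, generation 70 (CRUX PROVER NE7 #1); memo
`t4/b2b-balaban-t4-ne7-p1-g70/HUNT-H14-APE-FLAT-SKELETON.md` §4.  File F39 (over row NE3's `NE3CpushGaugeCovariance.dirIter_gaugeAct` ∕ `vary_gaugeAct`,
`NE3EnergyAssembly.fineAction_gaugeAct`, gen 66's `NE7ExactCurrent.hasDerivAt_fineAction_vary_dAction`).
WHAT ([folklore]; 0 def, 0 sorry).  §1 **`dAction_gaugeAct`** — the first variation is gauge covariant: `dAction (V^u) (ψ^u) W = dAction V ψ W`,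
`ψ^u(x,μ) = Ad_{u(x+e_μ)}ψ(x,μ)` (the window action is gauge invariant and `V^u e^{sψ^u} = (V e^{sψ})^u`; uniqueness of derivatives); `dress_undress`.
§2 **`tanCritical_gaugeAct`** — for `U` unitary in the class radius at level `k+1` and a unitary `P`-PERIODIC gauge `u`: if `dAction U φ (perWin d P) = 0`
for every skew `P`-periodic `φ` with `dirIter L (k+1) U φ = 0`, then `dAction (U^u) Y′ (perWin d P) = 0` for every skew `P`-periodic `Y′` with
`dirIter L (k+1) (U^u) Y′ = 0` (undress `Y′`, `dirIter_gaugeAct`, `Ad` injective).  USE: in F38 §4's bundle the supplier of REP♭ (`U^u = F̃e^{A}` with `u`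
unitary periodic — the residual gauge of row NE3's `ResidualSliceRepT` is of this kind) obtains the clause «criticality at the representative» from the
item's criticality at `U` by THIS theorem (with `tangentIter_iff_dirIter_eq_zero`).
HONEST FRAMING (page 1): lattice gauge calculus; nothing of Bałaban's asserted; NOT (APE), NOT ONE-STEP, NOT NE7; spine 0∕9; finite T⁴ rung (B)+1 — NOT
infinite volume, NOT mass gap, NOT Clay.  Continuum YM on T⁴ ⇐ BetaPertH ∧ nine spine estimates (0/9 proved); BetaPertH ⇐ (D1) ∧ (D4) ∧ CAP+tail;
G-an2-4 gates asym, D1 and NE2/3/4.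
-/

set_option autoImplicit false

open scoped BigOperators Matrix.Norms.L2Operator
open NormedSpace Finset Set

namespace Summit.QuantumFields.BalabanUV.T4Continuum.NE7TanCriticalGauge

open Literature.MathematicalPhysics.QuantumFieldTheory.Balaban1983to89
open B7Prop1Explicit B7Prop2Explicit MatrixLog UnitaryModel
open T4AveragingDeficitWall (IsUnitaryCfg IsSkewDir SmallField fineAction vary Ad)
open AveragingDeficitPeriodicCounting (IsPeriodicDir)
open AveragingDeficitMultiLevelPrep (LevelSmall)
open MinimalActionLevels (perWin)
open NE3HessForm (dAction)
open NE3TangentCovariantTower (dirIter)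
open NE3EnergyShapes (IsUnitarySite)
open NE3CpushGaugeCovariance (vary_gaugeAct dirIter_gaugeAct)
open NE3GaugeDirFrames (Ad_Ad_inv)
open NE3CovariantBlockPoincare (Ad_inv_Ad)
open NE3EnergyAssembly (fineAction_gaugeAct)
open AveragingDeficitTransport (Ad_mem_skewAdjoint)
open NE7ExactCurrent (hasDerivAt_fineAction_vary_dAction)
open NE7EtaMinimiserGaugeCovariance (isUnitarySite_inv)

noncomputable section

variable {d : ℕ} {n : Type*} [Fintype n] [DecidableEq n]

/-- **`dAction` IS GAUGE COVARIANT**: `dAction (V^u) (ψ^u) W = dAction V ψ W` for the dressed direction `ψ^u(x,μ) = Ad_{u(x+e_μ)} ψ(x,μ)`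
(the window action is gauge invariant, `fineAction_gaugeAct`; `V^u e^{sψ^u} = (V e^{sψ})^u`, `vary_gaugeAct`; uniqueness of derivatives). [folklore] -/
theorem dAction_gaugeAct (u : Site d → (Matrix n n ℂ)ˣ) (V : Site d → Fin d → (Matrix n n ℂ)ˣ) (ψ : Site d → Fin d → Matrix n n ℂ)
    (W : Finset (T4AveragingDeficitWall.Plaq d)) :
    dAction (gaugeAct u V) (fun x μ => Ad (u (x + e μ)) (ψ x μ)) W = dAction V ψ W := by
  have h1 := hasDerivAt_fineAction_vary_dAction (gaugeAct u V) (fun x μ => Ad (u (x + e μ)) (ψ x μ)) W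
  have h2 := hasDerivAt_fineAction_vary_dAction V ψ W
  have heq : (fun s : ℝ => fineAction (vary (gaugeAct u V) (fun x μ => Ad (u (x + e μ)) (ψ x μ)) s) W)
      = fun s : ℝ => fineAction (vary V ψ s) W := by
    funext s
    rw [vary_gaugeAct, fineAction_gaugeAct]
  rw [heq] at h1
  exact h1.unique h2

/-- Undressing: `ψ(x,μ) := Ad_{u(x+e_μ)⁻¹} Y′(x,μ)` dresses back to `Y′`. [folklore] -/
theorem dress_undress (u : Site d → (Matrix n n ℂ)ˣ) (Y' : Site d → Fin d → Matrix n n ℂ) :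
    (fun x μ => Ad (u (x + e μ)) (Ad (u (x + e μ))⁻¹ (Y' x μ))) = Y' := by
  funext x μ
  exact Ad_Ad_inv _ _

/-- **TANGENT-CRITICALITY IS GAUGE COVARIANT** (the «criticality at the representative» clause of F38's letter bundle, DISCHARGED for periodic
unitary gauges): `U` unitary in the class radius at level `k+1`, `u` unitary and `P`-periodic; if `dAction U φ (perWin d P) = 0` for every skew
`P`-periodic `φ` with `D_U φ = 0`, then `dAction (U^u) Y′ (perWin d P) = 0` for every skew `P`-periodic `Y′` with `D_{U^u} Y′ = 0`
(`D_W = dirIter L (k+1) W`; [tree] `dirIter_gaugeAct`, `fineAction_gaugeAct`). [folklore] -/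
theorem tanCritical_gaugeAct [Nonempty n] {L : ℕ} (hL : 1 ≤ L) (k : ℕ) {U : Site d → Fin d → (Matrix n n ℂ)ˣ} (hU : IsUnitaryCfg U)
    {x : ℝ} (hx : 0 ≤ x) (hs : LevelSmall d L k x) (hUx : SmallField U x) {P : ℕ}
    {u : Site d → (Matrix n n ℂ)ˣ} (hu : IsUnitarySite u) (huP : ∀ (y : Site d) (i : Fin d), u (y + (P : ℤ) • e i) = u y)
    (hcrit : ∀ φ : Site d → Fin d → Matrix n n ℂ, IsSkewDir φ → IsPeriodicDir φ (P : ℤ) → dirIter L (k + 1) U φ = 0 →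
      dAction U φ (perWin d P) = 0) :
    ∀ Y' : Site d → Fin d → Matrix n n ℂ, IsSkewDir Y' → IsPeriodicDir Y' (P : ℤ) → dirIter L (k + 1) (gaugeAct u U) Y' = 0 →
      dAction (gaugeAct u U) Y' (perWin d P) = 0 := by
  intro Y' hY's hY'P hY'T
  set ψ : Site d → Fin d → Matrix n n ℂ := fun y μ => Ad (u (y + e μ))⁻¹ (Y' y μ) with hψ
  have hdress : (fun y μ => Ad (u (y + e μ)) (ψ y μ)) = Y' := dress_undress u Y'
  -- `ψ` is skew and periodic
  have hψs : IsSkewDir ψ := fun y μ => Ad_mem_skewAdjoint (isUnitarySite_inv hu (y + e μ)) (hY's y μ)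
  have hψP : IsPeriodicDir ψ (P : ℤ) := by
    intro y i μ
    simp only [hψ]
    rw [hY'P y i μ, add_right_comm, huP]
  -- `ψ` is tangent at `U`
  have hψT : dirIter L (k + 1) U ψ = 0 := by
    have hg := dirIter_gaugeAct hL k hU hx hs hUx hu ψ
    rw [hdress, hY'T] at hg
    funext z κ
    have hz := congrFun (congrFun hg z) κ
    simp only [Pi.zero_apply] at hz
    have := congrArg (Ad (u (((L : ℤ) ^ (k + 1)) • (z + e κ)))⁻¹) hz
    rw [Ad_inv_Ad] at this
    simpa using this.symm
  -- criticality transported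
  rw [← hdress, dAction_gaugeAct]
  exact hcrit ψ hψs hψP hψT

end

end Summit.QuantumFields.BalabanUV.T4Continuum.NE7TanCriticalGauge
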